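import Literature.Probability.Percolation.FiveArmArms
import Literature.Probability.Percolation.CutPointArms
import HarnessLib

/-!
# The five-arm site of the lowest crossing, IV: the five-arm event around every nearby centre

Topic `Literature/Probability/Percolation`; family `crit-perc`. PROOFS ONLY (no definition, no named
fact). Fourth brick of the separation-free proof of the two-radii five-arm lower bound (W. Werner,
PCMI 2009, Lecture 6, §3, and first exercise sheet, "Five-arm exponent"; P. Nolin, EJP 13 (2008),
proof of Thm. 24 (ii) [arXiv 0711.4948: Thm. 23 (ii), p. 17]).

`exists_forall_relabel_shift_mem_armEvent_five` — under the hypotheses of `exists_fiveArms`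
(`FiveArmArms.lean`) and quantitative room (`2D ≤ min(a₁, a₂) - 1`, `max(b₁, b₂) + 1 + 2D ≤ M`,
explored sites at height `≤ N - D`), the five arms at Nolin's site `v` reach `𝕋`-distance `≥ D`
from `v`; hence for EVERY centre `z` with `|v - z|_𝕋 ≤ r` and radii `r + 1 < R ≤ D - r`, the
configuration seen from `z` (`ω - z`, `SiteConfig.relabel (triShiftIso (-z))`) lies in the tree's
five-arm event `armEvent ![T, T, T, F, F] (r + 1) R` (three open and two closed pairwise
vertex-disjoint self-avoiding arms from `∂Λ_{r+1}` to `∂Λ_R`; `ArmEvents.lean`, order of the arms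
not recorded): each arm is truncated to the annulus `{r + 1 ≤ |· - z|_𝕋 ≤ R}`
(`PathIn.exists_annulus_arm`: last exit from `Λ_{r+1}(z)`, then first arrival on `∂Λ_R(z)`),
translated by `-z` and fed to `mem_armEvent_of_pathIn`. This is the deterministic half of the
box-counting argument "a five-arm site somewhere in the box gives five arms around the centre of
its grid cell".

## References

* P. Nolin, Near-critical percolation in two dimensions, *Electron. J. Probab.* 13 (2008)
  1562–1623, §5.2, proof of Thm. 24 (ii) (arXiv 0711.4948: Thm. 23 (ii), p. 17) [Nolin2008].
* W. Werner, *Lectures on two-dimensional critical percolation*, IAS/Park City Math. Ser. 16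
  (2009), Lecture 6, §3; first exercise sheet, "Five-arm exponent" [WernerPCMI2009].
* S. Smirnov, W. Werner, Critical exponents for two-dimensional percolation, *Math. Res. Lett.* 8
  (2001), §3 (arm events) [SmirnovWernerMRL2001].

## Mathlib / tree

Tree: `exists_fiveArms` (`FiveArmArms.lean`), `mem_armEvent_of_pathIn`, `triShiftIso`,
`triNorm_sub_eq_one_of_adj` (`ParaPivotalArms.lean`, `TriSubcriticalCrossing.lean`),
`triNorm_add_le` (`CutPointArms.lean`), `triNorm_neg` (`ArmEventsAPriori.lean`), `abs_le_triNorm`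
(`OneArmLSW.lean`), `triNorm_le_triNorm_add_one_of_adj` (`ArmEventsProofs.lean`), `pathIn_map_iso`
(`TriRSWChaining.lean`), `PathIn.exit`, `PathIn.last_exit` (`SitePaths.lean`),
`SiteConfig.mem_relabel_iff` (`SitePercolationMeasure.lean`).
-/

noncomputable section

open Set

namespace Literature.Probability.Percolation

open LatticeModels

/-! ### Truncating a path to an annulus about an arbitrary centre -/

/-- Adjacency is preserved by subtracting a fixed site. [folklore] -/
theorem triGraph_adj_sub {a b : Site 2} (h : triGraph.Adj a b) (z : Site 2) :
    triGraph.Adj (a - z) (b - z) := by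
  have := (triGraph_adj_shift_iff (-z) a b).2 h
  simpa [Site.shift_apply, sub_eq_add_neg] using this

/-- **Truncating a path to an annulus.** A `𝕋`-path inside `S` from a site `a` with
`|a - z|_𝕋 ≤ r` to a site `b` with `|b - z|_𝕋 ≥ R > r` contains a segment inside
`S ∩ {r ≤ |· - z|_𝕋 ≤ R}` from a site at `𝕋`-distance exactly `r` from `z` to one at distance
exactly `R` (last exit from the ball of radius `r`, then first exit from the ball of radius `R - 1`;
the norm is `1`-Lipschitz along edges). [cite: SmirnovWernerMRL2001, §3 (arms crossing an annulus)] -/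
theorem PathIn.exists_annulus_arm {S : Set (Site 2)} {a b z : Site 2} {r R : ℕ}
    (hp : PathIn triGraph S a b) (ha : triNorm (a - z) ≤ r) (hb : (R : ℤ) ≤ triNorm (b - z))
    (hrR : r < R) :
    ∃ x y, triNorm (x - z) = r ∧ triNorm (y - z) = R ∧
      PathIn triGraph (S ∩ {w | (r : ℤ) ≤ triNorm (w - z) ∧ triNorm (w - z) ≤ R}) x y := by
  -- last exit from the ball of radius `r`
  set C : Set (Site 2) := {w | triNorm (w - z) ≤ r} with hC
  have hbC : b ∉ C := fun h => by change triNorm (b - z) ≤ r at h; omega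
  obtain ⟨a', b', ha'C, ha'S, hb'C, hab', hp'⟩ := hp.last_exit (C := C) ha hbC
  change triNorm (a' - z) ≤ r at ha'C
  change ¬ triNorm (b' - z) ≤ r at hb'C
  have hlip := triNorm_le_triNorm_add_one_of_adj (triGraph_adj_sub hab' z)
  have ha'r : triNorm (a' - z) = r := by omega
  -- the path from `a'` on, inside `S ∩ {r ≤ |· - z|}`
  set S' : Set (Site 2) := S ∩ {w | (r : ℤ) ≤ triNorm (w - z)} with hS'
  have hq : PathIn triGraph S' a' b := by
    have h1 : PathIn triGraph S' b' b := hp'.mono fun w hw => ⟨hw.1, by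
      have : ¬ triNorm (w - z) ≤ r := hw.2; show (r : ℤ) ≤ triNorm (w - z); omega⟩
    have ha'S' : a' ∈ S' := ⟨ha'S, by show (r : ℤ) ≤ triNorm (a' - z); omega⟩
    exact (PathIn.of_adj ha'S' h1.left_mem hab').trans h1
  -- first exit from the ball of radius `R - 1`
  set B : Set (Site 2) := {w | triNorm (w - z) < R} with hB
  have ha'B : a' ∈ B := by show triNorm (a' - z) < R; omega
  have hbB : b ∉ B := fun h => by change triNorm (b - z) < R at h; omega
  obtain ⟨c, d, hcB, hdB, hdS', hcd, hpc⟩ := hq.exit ha'B hbB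
  change triNorm (c - z) < R at hcB
  change ¬ triNorm (d - z) < R at hdB
  have hlip' := triNorm_le_triNorm_add_one_of_adj (triGraph_adj_sub hcd z)
  have hdR : triNorm (d - z) = R := by omega
  refine ⟨a', d, ha'r, hdR, (hpc.mono ?_).tail hcd ⟨hdS'.1, hdS'.2, hdR.le⟩⟩
  rintro w ⟨hwB, hwS'⟩
  exact ⟨hwS'.1, hwS'.2, le_of_lt hwB⟩

/-! ### The five-arm event around every centre near Nolin's site -/

variable {M N : ℕ} {ω : Set (Site 2)}

/-- The norm of a difference is symmetric. [folklore] -/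
theorem triNorm_sub_comm (x y : Site 2) : triNorm (x - y) = triNorm (y - x) := by
  rw [← triNorm_neg, neg_sub]

/-- A site of `R(M, N)` whose `x₀`- or `x₁`-coordinate differs from that of `v` by at least `D`
is at `𝕋`-distance at least `D` from `v`. [folklore] -/
theorem le_triNorm_sub_of_coord {q v : Site 2} {D : ℤ} (i : Fin 2)
    (h : D ≤ |q i - v i|) : D ≤ triNorm (q - v) := by
  obtain ⟨h0, h1, -⟩ := abs_le_triNorm (q - v)
  fin_cases i
  · exact h.trans (by simpa using h0)
  · exact h.trans (by simpa using h1)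

/-- **Five arms around every centre near Nolin's five-arm site** (Nolin 2008, proof of
Thm. 24 (ii); Werner 2009, first exercise sheet, "Five-arm exponent", 3: "there exists at least one
point `x` in `Λ_{m/2}` such that `U_{m/2}(x)` holds"). Under the hypotheses of `exists_fiveArms` and
the room conditions `2D ≤ min(a₁, a₂) - 1`, `max(b₁, b₂) + 1 + 2D ≤ M`, `e₁ + D ≤ N` for explored
`e`, there is a site `v` of the explored set such that for every centre `z` with `|v - z|_𝕋 ≤ r`
and all radii with `r + 1 < R`, `R + r ≤ D`, the translated configuration `ω - z` has three open
and two closed pairwise disjoint arms from `∂Λ_{r+1}` to `∂Λ_R`: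
`SiteConfig.relabel (triShiftIso (-z)) ω ∈ armEvent ![T, T, T, F, F] (r + 1) R`. [cite: Nolin2008, §5.2, proof of Thm. 24 (ii) (arXiv 0711.4948: Thm. 23 (ii), p. 17)] [cite: WernerPCMI2009, Lecture 2, first exercise sheet ("Five-arm exponent", 3))] -/
theorem exists_forall_relabel_shift_mem_armEvent_five {a₁ b₁ a₂ b₂ : ℤ} {D : ℕ}
    (ha₁ : 2 ≤ a₁) (hab₁ : a₁ ≤ b₁) (hb₁ : b₁ + 2 ≤ M) (ha₂ : 2 ≤ a₂)
    (hb₂ : b₂ + 2 ≤ M) (hDa : 2 * (D : ℤ) ≤ min a₁ a₂ - 1) (hDb : max b₁ b₂ + 1 + 2 * (D : ℤ) ≤ M)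
    (hH : ∀ e ∈ explored M N ω, e 1 + (D : ℤ) ≤ N)
    (hLR : LRPathIn M N ω) (hξ : LRPathIn M N ωᶜ)
    (htop : ∀ t ∈ topSide M N, t ∉ explored M N ω)
    (hO : ∃ t ∈ topSide M N, ∃ g e : Site 2, e ∈ explored M N ω ∧ triGraph.Adj g e ∧
      (a₁ ≤ g 0 ∧ g 0 ≤ b₁) ∧ PathIn triGraph ((↑(rectangle M N) \ ↑(explored M N ω)) ∩ ω) t g)
    (hK : ∃ t ∈ topSide M N, ∃ g e : Site 2, e ∈ explored M N ω ∧ triGraph.Adj g e ∧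
      (a₂ ≤ g 0 ∧ g 0 ≤ b₂) ∧ PathIn triGraph ((↑(rectangle M N) \ ↑(explored M N ω)) ∩ ωᶜ) t g) :
    ∃ v ∈ explored M N ω, ∀ (z : Site 2) (r R : ℕ), triNorm (v - z) ≤ r → r + 1 < R →
      R + r ≤ D →
        SiteConfig.relabel (triShiftIso (-z)).toEquiv ω ∈
          armEvent ![true, true, true, false, false] (r + 1) R := by
  classical
  obtain ⟨v, hvE, S₀, S₁, S₂, S₃, S₄, h01, hS₀, hS₁, hS₂, hS₃, hS₄, hhor, hup, hdown⟩ :=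
    exists_fiveArms ha₁ hb₁ ha₂ hb₂ hLR hξ htop hO hK
  have hvR : v ∈ rectangle M N := explored_subset ω hvE
  have hv0 := (mem_rectangle_iff.1 hvR).1
  have hv0' := (mem_rectangle_iff.1 hvR).2.1
  have hvN := hH v hvE
  /- each arm: a start next to `v` and a far site at `𝕋`-distance `≥ D` from `v` -/
  have harm : ∀ S, (S = S₀ ∨ S = S₁ ∨ S = S₂ ∨ S = S₃ ∨ S = S₄) →
      ∃ w q, triGraph.Adj v w ∧ PathIn triGraph S w q ∧ (D : ℤ) ≤ triNorm (q - v) := by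
    have hnear : ∀ {q : Site 2}, ((a₁ - 1 ≤ q 0 ∧ q 0 ≤ b₁ + 1) ∨ (a₂ - 1 ≤ q 0 ∧ q 0 ≤ b₂ + 1)) →
        2 * (D : ℤ) ≤ q 0 ∧ q 0 + 2 * D ≤ M := by
      rintro q (⟨h1, h2⟩ | ⟨h1, h2⟩)
      · constructor
        · have := min_le_left a₁ a₂; omega
        · have := le_max_left b₁ b₂; omega
      · constructor
        · have := min_le_right a₁ a₂; omega
        · have := le_max_right b₁ b₂; omega
    have hhor' : ∀ S, (S = S₀ ∨ S = S₁) →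
        ∃ w q, triGraph.Adj v w ∧ PathIn triGraph S w q ∧ (D : ℤ) ≤ triNorm (q - v) := by
      intro S hS
      obtain ⟨w, -, hvw, ⟨s, hws, hs⟩, hcol⟩ := hhor S hS
      -- is the vertical side reached by `s` already far?
      by_cases hfar : (D : ℤ) ≤ |s 0 - v 0|
      · exact ⟨w, s, hvw, hws, le_triNorm_sub_of_coord 0 hfar⟩
      · rw [not_le] at hfar
        rcases hcol with ⟨s', hws', hs'⟩ | hvnear
        · refine ⟨w, s', hvw, hws', le_triNorm_sub_of_coord 0 ?_⟩
          have := hnear hs'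
          rcases hs with hs | hs <;> · rw [hs, abs_lt] at hfar; rw [le_abs]; omega
        · exfalso
          have := hnear hvnear
          rcases hs with hs | hs <;> · rw [hs, abs_lt] at hfar; omega
    intro S hS
    rcases hS with h | h | h | h | h
    · exact hhor' _ (Or.inl h)
    · exact hhor' _ (Or.inr h)
    · rw [h]
      obtain ⟨w, -, hvw, s, hws, hs⟩ := hup S₂ (Or.inl rfl)
      exact ⟨w, s, hvw, hws, le_triNorm_sub_of_coord 1 (by rw [hs, le_abs]; omega)⟩
    · rw [h]
      obtain ⟨w, -, hvw, s, s', hws, hws', hs, hs'⟩ := hdown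
      by_cases hfar : (D : ℤ) ≤ v 0
      · exact ⟨w, s, hvw, hws, le_triNorm_sub_of_coord 0 (by rw [hs, le_abs]; omega)⟩
      · refine ⟨w, s', hvw, hws', le_triNorm_sub_of_coord 0 ?_⟩
        have := le_max_left b₁ b₂
        rw [hs', le_abs]; omega
    · rw [h]
      obtain ⟨w, -, hvw, s, hws, hs⟩ := hup S₄ (Or.inr rfl)
      exact ⟨w, s, hvw, hws, le_triNorm_sub_of_coord 1 (by rw [hs, le_abs]; omega)⟩
  refine ⟨v, hvE, fun z r R hvz hrR hRD => ?_⟩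
  /- the five truncated, translated arms about the centre `z` -/
  set φ := triShiftIso (-z) with hφ
  have hφapp : ∀ w, φ w = w - z := fun w => by simp [hφ, sub_eq_add_neg]
  set Ann : Set (Site 2) := {w | ((r + 1 : ℕ) : ℤ) ≤ triNorm (w - z) ∧ triNorm (w - z) ≤ R}
    with hAnn
  have himage : ∀ (T : Set (Site 2)) (w : Site 2), w ∈ φ '' T ↔ w + z ∈ T := by
    intro T w
    constructor
    · rintro ⟨w', hw', rfl⟩; rw [hφapp]; simpa using hw'
    · intro hw; exact ⟨w + z, hw, by rw [hφapp]; simp⟩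
  have hmemω : ∀ w, w ∈ SiteConfig.relabel φ.toEquiv ω ↔ w + z ∈ ω := by
    intro w
    rw [SiteConfig.mem_relabel_iff]
    have : φ.toEquiv.symm w = w + z := by
      apply φ.toEquiv.injective
      rw [Equiv.apply_symm_apply]
      show w = φ (w + z)
      rw [hφapp]; simp
    rw [this]
  -- truncation of an arm of `S` to the annulus about `z`
  have htrunc : ∀ S, (S = S₀ ∨ S = S₁ ∨ S = S₂ ∨ S = S₃ ∨ S = S₄) →
      ∃ x ∈ triSphere (r + 1), ∃ y ∈ triSphere R, PathIn triGraph (φ '' (S ∩ Ann)) x y := by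
    intro S hS
    obtain ⟨w, q, hvw, hwq, hq⟩ := harm S hS
    have hwz : triNorm (w - z) ≤ ((r + 1 : ℕ) : ℤ) := by
      have h1 : triNorm (w - v) = 1 := triNorm_sub_eq_one_of_adj hvw.symm
      have := triNorm_add_le (w - v) (v - z)
      rw [show w - v + (v - z) = w - z by abel] at this
      push_cast; omega
    have hqz : (R : ℤ) ≤ triNorm (q - z) := by
      have := triNorm_add_le (q - z) (z - v)
      rw [show q - z + (z - v) = q - v by abel, triNorm_sub_comm z v] at this
      omega
    obtain ⟨x, y, hx, hy, hp⟩ := hwq.exists_annulus_arm hwz hqz hrR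
    refine ⟨φ x, ?_, φ y, ?_, pathIn_map_iso φ hp⟩
    · rw [mem_triSphere_iff, hφapp, hx]
    · rw [mem_triSphere_iff, hφapp, hy]
  -- the translated supports
  let T : Fin 5 → Set (Site 2) :=
    ![φ '' (S₀ ∩ Ann), φ '' (S₁ ∩ Ann), φ '' (S₂ ∩ Ann), φ '' (S₃ ∩ Ann), φ '' (S₄ ∩ Ann)]
  -- colours
  have hS₀ω : ∀ w ∈ S₀, w ∈ ω := fun w hw => (hS₀ hw).2
  have hS₁ω : ∀ w ∈ S₁, w ∈ ω := fun w hw => (hS₁ hw).2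
  have hS₂ω : ∀ w ∈ S₂, w ∈ ω := fun w hw => (hS₂ hw).2
  have hS₃ω : ∀ w ∈ S₃, w ∉ ω := fun w hw => (hS₃ hw).2
  have hS₄ω : ∀ w ∈ S₄, w ∉ ω := fun w hw => (hS₄ hw).2
  have hcolT : ∀ i, ∀ w ∈ T i, (w ∈ SiteConfig.relabel φ.toEquiv ω ↔
      (![true, true, true, false, false] : Fin 5 → Bool) i = true) := by
    intro i w hw
    rw [hmemω]
    fin_cases i
    · change w ∈ φ '' (S₀ ∩ Ann) at hw; rw [himage] at hw; simpa using hS₀ω _ hw.1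
    · change w ∈ φ '' (S₁ ∩ Ann) at hw; rw [himage] at hw; simpa using hS₁ω _ hw.1
    · change w ∈ φ '' (S₂ ∩ Ann) at hw; rw [himage] at hw; simpa using hS₂ω _ hw.1
    · change w ∈ φ '' (S₃ ∩ Ann) at hw; rw [himage] at hw; simpa using hS₃ω _ hw.1
    · change w ∈ φ '' (S₄ ∩ Ann) at hw; rw [himage] at hw; simpa using hS₄ω _ hw.1
  refine mem_armEvent_of_pathIn _ T ?_ hcolT ?_ ?_
  · -- pairwise disjointness
    have key : ∀ {A B : Set (Site 2)}, (∀ w ∈ A, ∀ w' ∈ B, w ≠ w') →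
        Disjoint (φ '' (A ∩ Ann)) (φ '' (B ∩ Ann)) := by
      intro A B hAB
      rw [Set.disjoint_left]
      intro w hwA hwB
      rw [himage] at hwA hwB
      exact hAB _ hwA.1 _ hwB.1 rfl
    -- separations: colour, and explored versus the region above
    have oc : ∀ {A B : Set (Site 2)}, (∀ w ∈ A, w ∈ ω) → (∀ w ∈ B, w ∉ ω) →
        ∀ w ∈ A, ∀ w' ∈ B, w ≠ w' := fun hA hB w hw w' hw' hww' => hB w' hw' (hww' ▸ hA w hw)
    have co : ∀ {A B : Set (Site 2)}, (∀ w ∈ A, w ∉ ω) → (∀ w ∈ B, w ∈ ω) →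
        ∀ w ∈ A, ∀ w' ∈ B, w ≠ w' := fun hA hB w hw w' hw' hww' => hA w hw (hww' ▸ hB w' hw')
    have ea : ∀ {A B : Set (Site 2)}, (∀ w ∈ A, w ∈ explored M N ω) → (∀ w ∈ B, w ∈ aboveSet M N ω) →
        ∀ w ∈ A, ∀ w' ∈ B, w ≠ w' := fun hA hB w hw w' hw' hww' =>
      (mem_rectangle_of_mem_aboveSet (hB w' hw')).2 (hww' ▸ hA w hw)
    have ae : ∀ {A B : Set (Site 2)}, (∀ w ∈ A, w ∈ aboveSet M N ω) → (∀ w ∈ B, w ∈ explored M N ω) →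
        ∀ w ∈ A, ∀ w' ∈ B, w ≠ w' := fun hA hB w hw w' hw' hww' =>
      (mem_rectangle_of_mem_aboveSet (hA w hw)).2 (hww' ▸ hB w' hw')
    have hS₀E : ∀ w ∈ S₀, w ∈ explored M N ω := fun w hw => Finset.mem_coe.1 (hS₀ hw).1
    have hS₁E : ∀ w ∈ S₁, w ∈ explored M N ω := fun w hw => Finset.mem_coe.1 (hS₁ hw).1
    have hS₃E : ∀ w ∈ S₃, w ∈ explored M N ω := fun w hw => Finset.mem_coe.1 (hS₃ hw).1
    have hS₂A : ∀ w ∈ S₂, w ∈ aboveSet M N ω := fun w hw => (hS₂ hw).1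
    have hS₄A : ∀ w ∈ S₄, w ∈ aboveSet M N ω := fun w hw => (hS₄ hw).1
    have d01 : ∀ w ∈ S₀, ∀ w' ∈ S₁, w ≠ w' := fun w hw w' hw' hww' =>
      Set.disjoint_left.1 h01 hw (hww' ▸ hw')
    have d10 : ∀ w ∈ S₁, ∀ w' ∈ S₀, w ≠ w' := fun w hw w' hw' hww' => d01 w' hw' w hw hww'.symm
    intro i j hij
    fin_cases i <;> fin_cases j
    · exact absurd rfl hij
    · exact key d01
    · exact key (ea hS₀E hS₂A)
    · exact key (oc hS₀ω hS₃ω)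
    · exact key (ea hS₀E hS₄A)
    · exact key d10
    · exact absurd rfl hij
    · exact key (ea hS₁E hS₂A)
    · exact key (oc hS₁ω hS₃ω)
    · exact key (ea hS₁E hS₄A)
    · exact key (ae hS₂A hS₀E)
    · exact key (ae hS₂A hS₁E)
    · exact absurd rfl hij
    · exact key (ae hS₂A hS₃E)
    · exact key (oc hS₂ω hS₄ω)
    · exact key (co hS₃ω hS₀ω)
    · exact key (co hS₃ω hS₁ω)
    · exact key (ea hS₃E hS₂A)
    · exact absurd rfl hij
    · exact key (ea hS₃E hS₄A)
    · exact key (ae hS₄A hS₀E)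
    · exact key (ae hS₄A hS₁E)
    · exact key (co hS₄ω hS₂ω)
    · exact key (ae hS₄A hS₃E)
    · exact absurd rfl hij
  · -- the supports lie in the annulus `{r + 1 ≤ |·| ≤ R}`
    have key : ∀ (A : Set (Site 2)), ∀ w ∈ φ '' (A ∩ Ann),
        ((r + 1 : ℕ) : ℤ) ≤ triNorm w ∧ triNorm w ≤ R := by
      intro A w hw
      rw [himage] at hw
      obtain ⟨-, h1, h2⟩ := hw
      have e : w + z - z = w := by simp
      rw [e] at h1 h2
      exact ⟨h1, h2⟩
    intro i
    fin_cases i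
    · exact key S₀
    · exact key S₁
    · exact key S₂
    · exact key S₃
    · exact key S₄
  · -- each support contains an arm from `∂Λ_{r+1}` to `∂Λ_R`
    intro i
    fin_cases i
    · exact htrunc S₀ (Or.inl rfl)
    · exact htrunc S₁ (Or.inr (Or.inl rfl))
    · exact htrunc S₂ (Or.inr (Or.inr (Or.inl rfl)))
    · exact htrunc S₃ (Or.inr (Or.inr (Or.inr (Or.inl rfl))))
    · exact htrunc S₄ (Or.inr (Or.inr (Or.inr (Or.inr rfl))))

end Literature.Probability.Percolation
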